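import Mathlib

/-!
# Solo-blind kernel #285 — Fatou closure of the weighted mass bound (Galerkin route to the infinite chain)

The typed [A′](a) chain (#266–#284) bounds the weighted mass `∫₀^∞ ‖k_J(t)‖ e^{γt} dt ≤ X` of the
read-out kernel of every TRUNCATED chain `J` (bounded generator, #270 gives `𝓛 k_J = R_J`).  The
physical kernel is the limit `k = lim_J k_J` (Galerkin).  This file is the closing step: a uniform
bound `≤ X` for all `J` and a.e. convergence `k_J → k` give integrability of `‖k‖e^{γt}` and the same
bound for `k` (Fatou) — no semigroup theory for the unbounded infinite chain is needed.
-/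

namespace Summit.AnomalousDissipation.SoloBlind.FatouMass

open MeasureTheory Set Filter Topology

variable {E : Type*} [NormedAddCommGroup E]

/-- Fatou for a sequence of nonnegative real functions on a measure space with uniformly bounded
integrals and an a.e. limit: the limit is integrable and its integral obeys the same bound. -/
theorem integral_le_of_tendsto_ae {α : Type*} [MeasurableSpace α] {μ : Measure α}
    {f : ℕ → α → ℝ} {g : α → ℝ} {X : ℝ}
    (hf0 : ∀ n, 0 ≤ᵐ[μ] f n) (hfi : ∀ n, Integrable (f n) μ) (hle : ∀ n, ∫ a, f n a ∂μ ≤ X)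
    (hg : AEStronglyMeasurable g μ) (hlim : ∀ᵐ a ∂μ, Tendsto (fun n => f n a) atTop (𝓝 (g a))) :
    Integrable g μ ∧ ∫ a, g a ∂μ ≤ X := by
  have hX : 0 ≤ X := le_trans (integral_nonneg_of_ae (hf0 0)) (hle 0)
  have hg0 : 0 ≤ᵐ[μ] g := by
    have hall : ∀ᵐ a ∂μ, ∀ n, 0 ≤ f n a := ae_all_iff.2 hf0
    filter_upwards [hall, hlim] with a ha hl
    exact ge_of_tendsto' hl (fun n => ha n)
  -- lintegral Fatou
  have hF : ∫⁻ a, ENNReal.ofReal (g a) ∂μ ≤ ENNReal.ofReal X := by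
    have hlim' : ∀ᵐ a ∂μ, Tendsto (fun n => ENNReal.ofReal (f n a)) atTop (𝓝 (ENNReal.ofReal (g a))) := by
      filter_upwards [hlim] with a hl
      exact (ENNReal.continuous_ofReal.tendsto _).comp hl
    have h1 : ∫⁻ a, ENNReal.ofReal (g a) ∂μ = ∫⁻ a, liminf (fun n => ENNReal.ofReal (f n a)) atTop ∂μ := by
      refine lintegral_congr_ae ?_
      filter_upwards [hlim'] with a hl
      exact hl.liminf_eq.symm
    have hmeas : ∀ n, AEMeasurable (fun a => ENNReal.ofReal (f n a)) μ :=
      fun n => (hfi n).aestronglyMeasurable.aemeasurable.ennreal_ofReal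
    rw [h1]
    refine le_trans (lintegral_liminf_le' hmeas) ?_
    refine liminf_le_of_frequently_le' (Frequently.of_forall fun n => ?_)
    rw [← ofReal_integral_eq_lintegral_ofReal (hfi n) (hf0 n)]
    exact ENNReal.ofReal_le_ofReal (hle n)
  have hgi : Integrable g μ := by
    refine ⟨hg, ?_⟩
    have : ∫⁻ a, ‖g a‖ₑ ∂μ = ∫⁻ a, ENNReal.ofReal (g a) ∂μ := by
      refine lintegral_congr_ae ?_
      filter_upwards [hg0] with a ha
      rw [Real.enorm_eq_ofReal ha]
    rw [HasFiniteIntegral, this]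
    exact lt_of_le_of_lt hF ENNReal.ofReal_lt_top
  refine ⟨hgi, ?_⟩
  have h2 : ENNReal.ofReal (∫ a, g a ∂μ) ≤ ENNReal.ofReal X := by
    rw [ofReal_integral_eq_lintegral_ofReal hgi hg0]; exact hF
  exact (ENNReal.ofReal_le_ofReal_iff hX).1 h2

/-- **Fatou closure of the [A′] mass bound.**  Truncated-chain kernels `k J` with weighted masses
`∫_{(0,∞)} ‖k J t‖ e^{γt} ≤ X` for every `J`, converging a.e. on `(0,∞)` to `kinf` (a.e.-strongly
measurable): `‖kinf‖e^{γt}` is integrable on `(0,∞)` with the same bound. -/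
theorem mass_le_of_tendsto {k : ℕ → ℝ → E} {kinf : ℝ → E} {γ X : ℝ}
    (hint : ∀ J, IntegrableOn (fun t => ‖k J t‖ * Real.exp (γ * t)) (Ioi 0))
    (hle : ∀ J, ∫ t in Ioi 0, ‖k J t‖ * Real.exp (γ * t) ≤ X)
    (hmeas : AEStronglyMeasurable kinf (volume.restrict (Ioi 0)))
    (hlim : ∀ᵐ t ∂(volume.restrict (Ioi 0)), Tendsto (fun J => k J t) atTop (𝓝 (kinf t))) :
    IntegrableOn (fun t => ‖kinf t‖ * Real.exp (γ * t)) (Ioi 0) ∧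
      ∫ t in Ioi 0, ‖kinf t‖ * Real.exp (γ * t) ≤ X := by
  refine integral_le_of_tendsto_ae (μ := volume.restrict (Ioi 0))
    (f := fun J t => ‖k J t‖ * Real.exp (γ * t)) (g := fun t => ‖kinf t‖ * Real.exp (γ * t))
    (fun J => Eventually.of_forall fun t => by positivity) hint hle ?_ ?_
  · exact hmeas.norm.mul (by fun_prop : Continuous fun t : ℝ => Real.exp (γ * t)).aestronglyMeasurable
  · filter_upwards [hlim] with t ht
    exact (continuous_norm.tendsto _ |>.comp ht).mul tendsto_const_nhds

end Summit.AnomalousDissipation.SoloBlind.FatouMass
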